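import Literature.MathematicalPhysics.QuantumFieldTheory.Balaban1983to89.B2Ineq347SumToSup

/-!
# `Balaban1983to89.B2Ineq342From346` — [Balaban1982Higgs2] Sect. 3.C pp. 592–594, part 3/3: the BYPASS — (3.42)
# (`B2.Ineq342With`) and the claim of Sect. 3.C (`B2.Claim342Printed`) from the (3.46) shape, the (3.52)-shape
# bounds for `|Λ₀⁽ᵏ⁾ᶜ|` AND for the collars `|Λ₇…|`, `|Λ₅…|`, the sequence count of part 1, and the kernel-checked
# (3.53)–(3.54) (`B2Sect3C.exponent_nonpos`) — WITHOUT the unprinted leaf (3.47)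

statement-level skeleton of published theorems with citation tags; proofs where landed; nothing here is a claim about the Yang–Mills mass gap

PDF held: `paper:balaban1982-cmp86-higgs23-ii` (T. Bałaban, *(Higgs)₂,₃ quantum fields in a finite volume. II. An upper
bound*, Commun. Math. Phys. **86** (1982) 555–594 [Balaban1982Higgs2]; journal page = PDF page + 554); pp. 592–594
[PDF 38–40] READ AS IMAGES on `run/shared/lean/pub/pub-balaban/b2b-balaban-ref1/pages/1982-cmp86-higgs23-II/
1982-cmp86-higgs23-II-p038-x2.png`, `…-p039-x2.png`, `…-p040-x2.png`, with pp. 557–559, 566 [PDF 3–5, 12] (p(ε), (2.7)–(2.8),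
(2.13)–(2.15), "admissible") and part I p. 607 [PDF 5 of `1982-cmp85-higgs23-I`] ((1.19)–(1.21): blocks, large blocks = cubes
of side `ML`, `|Λ|` = number of points on the unit lattice).

CITATION HEADER (lean-in-tree rule).  Cell `lit-balaban` (HOME `run/shared/lean/pub/lit-balaban/`), Phase-2 proof seat
**p23** gen 8 (unit `lit-balaban-p23-g8`); SKELETON rows **B2.Eq3.42** ((3.41)–(3.42) p. 592 + proviso p. 594; decl of
record `B2.Claim342Printed`) and **B2.Eq3.47** ((3.43)–(3.54) pp. 592–594; decls `B2Sect3C.Leaf347`, `Bound350`, …);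
fold owner r02, second reader r14, referee ref-4.  Located gap of record: cell `pub-balaban` GAPS.md **G-pv04-3**
(items (i) SUM → SUP, (ii) COLLARS, (iii) the k = K terms and the origin of the weight `1 + log(Lᵏε)⁻¹`), which asks
verbatim for *"a proof of `B2Sect3C.Leaf347 P ρ X A B` … from (3.42)'s left side + (3.46) + a STATED sequence-count
lemma (i) + STATED collar bounds (ii)"*.  This file is part 3 of 3 (`B2Ineq347SeqCount` → `B2Ineq347SumToSup` → `B2Ineq342From346`); it works over the
carriers of `…Balaban1983to89.B2` (`Params`, `Run`, `lhs342`, `Ineq342With`, `Claim342Printed`, `coeff354_threshold`,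
`logScale_ge`) and `…Balaban1983to89.B2Sect3C` (`CData`, `epsK`, `xk`, `rhs347`, `Bound352`, `exponent_nonpos`, `c0_pos`,
`one_le_xk`) and uses parts 1–2 (`entropy_of_blocks`, `summand_mul_le_rhs347`) BY NAME.  Nothing of
another seat is restated; no definition is introduced (theorems only).

WHY A BYPASS (G-pv04-3 (ii)).  The printed middle factor of (3.47), `exp(Σ_k O(1)(1 + log(Lᵏε)⁻¹)|Λ₀⁽ᵏ⁾ᶜ|)`
(*"we have gathered all the expressions dependent on Λ₀⁽ᵏ⁾ᶜ"*), is NOT an upper bound for the collar factors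
`exp(Σ O(1)(Lᵏε)^{κ₀}|Λ₇⁽ᵏ⁻¹⁾′∩Λ₇⁽ᵏ⁾ᶜ|)·exp(Σ O(1)|Λ₅⁽ᵏ⁻¹⁾′∩Λ₅⁽ᵏ⁾ᶜ|)` of (3.42) via `|Λ₀⁽ᵏ⁾ᶜ|` in general (part 2,
`leaf347_of_346`, carries that as a hypothesis).  What the corridor construction (3.48)–(3.52) gives instead is the
(3.52)-SHAPE bound `|Λ₅⁽ᵏ⁾ᶜ|, |Λ₇⁽ᵏ⁾ᶜ| ≤ O(1)r(Lᵏε)ᵈ(|𝒞₀| + … + |𝒞_k|)` (cubes of 𝒟_k fattened by 7r(Lᵏε)), and with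
THAT input the kernel-checked (3.53)–(3.54) absorb the collars exactly as they absorb `|Λ₀⁽ᵏ⁾ᶜ|`: this file applies
`B2Sect3C.exponent_nonpos` to the combined volume `|Λ₀⁽ᵏ⁾ᶜ| + |Λ₇…| + |Λ₅…|` and proves (3.42) directly — the RESULT
of Sect. 3.C without its undisplayed intermediate display.

WHAT IS KERNEL-CHECKED (zero `sorry`, no `def`; axioms standard).
 **`ineq342_of_346 : … → B2.Ineq342With P ρ (C₇ + C₅ + E)`** — (3.42) for one run from the (3.46) shape + `Bound352 D` +
    the (3.52)-shape collar bounds (`D₇`, `D₅`) + the k = K volumes + the sequence count `E` + the per-scale (3.54)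
    condition with `O(1) = (a₆ + θ + C₇ + C₅)(D + D₇ + D₅)/(R log L)`;
 **`claim342_of_346`** — the family form with the quantifier structure of `B2.Claim342Printed` (STRICT case
    `2p > (d+1)r`, *"ε₀ is sufficiently small"* = `ε₀ ≤ min{1, e^{1−x₀}}`, as in `B2Sect3C.claim342_of_leaves`), concluding
    `B2.Claim342Printed P fam` BY NAME without the leaf (3.47);
 **`ineq342_of_346_blocks`** — END TO END for one run: `ineq342_of_346` with its sequence-count hypothesis discharged
    by part 1's `entropy_of_blocks` (`E = 1/m`).

HONEST SCOPE.  (a) Carriers are the abstract ones of `B2`/`B2Sect3C` (pure data): IMPLICATIONS between printed-shape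
statements; no concrete multi-scale region model is built here.  (b) After parts 1–3 the ONLY inputs of the §3.C chain
`… ⇒ B2.Claim342Printed` that are neither printed displays nor proved are the corridor leaf `B2Sect3C.Bound350`
((3.50), geometric) and its two collar analogues (the (3.52)-shape bounds for `|Λ₇⁽ᵏ⁾ᶜ|`, `|Λ₅⁽ᵏ⁾ᶜ|`, same construction);
the (3.46) shape is r14's theorem `B2Eq341Zeta.zeta341_le` for every admissible-tuple dictionary; the sequence count is
part 1's theorem for large-block sequences.  (c) `r ≥ 2` and the strict `2p > (d+1)r` are inherited from `B2Sect3C`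
(cell GAPS G-pv04-2).  (d) Value = the result (3.42) of a passage two later papers import by reference ("model
independent", B10 p. 274; "the same combinatorics", B14 p. 264) derived in the kernel from named printed-shape inputs,
bypassing the unprinted (3.47); NOT summit progress.
-/

namespace Literature.MathematicalPhysics.QuantumFieldTheory.Balaban1983to89.B2Ineq342From346

open Finset
open Literature.MathematicalPhysics.QuantumFieldTheory.Balaban1983to89
open Literature.MathematicalPhysics.QuantumFieldTheory.Balaban1983to89.B2
open Literature.MathematicalPhysics.QuantumFieldTheory.Balaban1983to89.B2Sect3C
open Literature.MathematicalPhysics.QuantumFieldTheory.Balaban1983to89.B2Ineq347SeqCount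
open Literature.MathematicalPhysics.QuantumFieldTheory.Balaban1983to89.B2Ineq347SumToSup

/-! ## (3.42) for ONE run from (3.46) + (3.52)-shape bounds, WITHOUT (3.47) -/

/-- `Π_{k∈s} e^{−f k} = e^{−Σ_{k∈s} f k}`. [folklore] -/
private theorem prod_exp_neg (s : Finset ℕ) (f : ℕ → ℝ) :
    ∏ k ∈ s, Real.exp (-f k) = Real.exp (-∑ k ∈ s, f k) := by
  rw [← Finset.sum_neg_distrib, Real.exp_sum]


/-- **(3.42) for one run WITHOUT the leaf (3.47).**  GIVEN, at every admissible sequence: the (3.46) shape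
`0 ≤ ζ″_k ≤ e^{a₆|Λ₀⁽ᵏ⁾ᶜ|}e^{−c₀p(Lᵏε)²|𝒞_k|}`; the (3.52) bound `|Λ₀⁽ᵏ⁾ᶜ| ≤ D r(Lᵏε)ᵈ(|𝒞₀| + … + |𝒞_k|)`
(`B2Sect3C.Bound352`, e.g. from the corridor leaf (3.50) by `B2Sect3C.bound352_of_350`) and the SAME SHAPE for the
collars, `|Λ₇⁽ᵏ⁻¹⁾′∩Λ₇⁽ᵏ⁾ᶜ| ≤ D₇ r(Lᵏε)ᵈΣ_{j≤k}|𝒞_j|`, `|Λ₅⁽ᵏ⁻¹⁾′∩Λ₅⁽ᵏ⁾ᶜ| ≤ D₅ r(Lᵏε)ᵈΣ_{j≤k}|𝒞_j|` (k < K; what the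
corridor construction gives for the collars — cell GAPS G-pv04-3 (ii)); the k = K volumes `≤ |T₁⁽ᴷ⁾| ≤ |T_ε|`; the
sequence count `Σ_s Π_{k<K} e^{−θx_k|Λ₀⁽ᵏ⁾ᶜ|(s)} ≤ e^{E|T₁⁽ᴷ⁾|}`; and the per-scale (3.54) condition with
`O(1) = (a₆ + θ + C₇ + C₅)(D + D₇ + D₅)/(R log L)` (supplied by *"2p ≥ (d+1)r and ε₀ sufficiently small"*,
`B2.coeff354_threshold`) — THEN `(3.42)`: `lhs342 ≤ exp((C₇ + C₅ + E)|T_ε|)`.  Route: per sequence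
`F(s) ≤ w(s)·rhs347[combined volume](s) ≤ w(s)·e^{(C₇+C₅)|T₁⁽ᴷ⁾|}` by `summand_mul_le_rhs347` and
`B2Sect3C.exponent_nonpos` ((3.53)–(3.54)) applied to `|Λ₀⁽ᵏ⁾ᶜ| + |Λ₇…| + |Λ₅…|`, then sum the weights.
[cite: Balaban1982Higgs2, (3.42) p.592, (3.46)–(3.54) pp.593–594] -/
theorem ineq342_of_346 (P : Params) (ρ : Run) (X : CData ρ) {a₆ θ D D₇ D₅ E : ℝ}
    (hL : 1 < (P.L : ℝ)) (hR : 0 < P.R) (hr : 2 ≤ P.r) (hε : 0 < ρ.ε) (hK1 : epsK P ρ ρ.K ≤ 1) (hκ : 0 ≤ P.κ₀)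
    (hC₇ : 0 ≤ ρ.C₇) (hC₅ : 0 ≤ ρ.C₅) (ha₆ : 0 ≤ a₆) (hθ : 0 ≤ θ) (hD : 0 ≤ D) (hD₇ : 0 ≤ D₇) (hD₅ : 0 ≤ D₅)
    (hE : 0 ≤ E) (hT : X.volTK ≤ ρ.volT)
    (hz : ∀ s k, k < ρ.K → 0 ≤ ρ.zeta k s)
    (h346 : ∀ s k, k < ρ.K → ρ.zeta k s ≤ Real.exp (a₆ * (X.vol0c k s : ℝ)) *
        Real.exp (-(c0 P.a P.γ₀ P.d * pFn P.b₀ P.p (epsK P ρ k) ^ 2 * (X.nC k s : ℝ))))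
    (h352 : Bound352 P ρ X D)
    (h7 : ∀ s k, k < ρ.K → (ρ.vol7 k s : ℝ)
        ≤ D₇ * rFn P.R P.r (epsK P ρ k) ^ P.d * ∑ j ∈ range (k + 1), (X.nC j s : ℝ))
    (h5 : ∀ s k, k < ρ.K → (ρ.vol5 k s : ℝ)
        ≤ D₅ * rFn P.R P.r (epsK P ρ k) ^ P.d * ∑ j ∈ range (k + 1), (X.nC j s : ℝ))
    (h7K : ∀ s, ρ.vol7 ρ.K s ≤ X.volTK) (h5K : ∀ s, ρ.vol5 ρ.K s ≤ X.volTK)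
    (hent : (letI := ρ.fin; ∑ s : ρ.Seq, ∏ k ∈ range ρ.K, Real.exp (-(θ * xk P ρ k * (X.vol0c k s : ℝ))))
        ≤ Real.exp (E * (X.volTK : ℝ)))
    (hcond : ∀ k, k < ρ.K →
        (a₆ + θ + ρ.C₇ + ρ.C₅) * (D + D₇ + D₅) / (P.R * Real.log (P.L : ℝ)) * P.R ^ (P.d + 1)
          ≤ c0 P.a P.γ₀ P.d * P.b₀ ^ 2 * xk P ρ k ^ (2 * P.p - ((P.d : ℝ) + 1) * P.r)) :
    Ineq342With P ρ (ρ.C₇ + ρ.C₅ + E) := by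
  letI := ρ.fin
  have hL1 : 1 ≤ (P.L : ℝ) := hL.le
  -- the combined volume |Λ₀ᶜ| + |Λ₇…| + |Λ₅…| as a `CData`
  let X' : CData ρ := ⟨X.nC, fun k s => X.vol0c k s + ρ.vol7 k s + ρ.vol5 k s, X.volTK⟩
  have hv' : ∀ k s, (X'.vol0c k s : ℝ) = (X.vol0c k s : ℝ) + (ρ.vol7 k s : ℝ) + (ρ.vol5 k s : ℝ) := by
    intro k s
    show ((X.vol0c k s + ρ.vol7 k s + ρ.vol5 k s : ℕ) : ℝ) = _
    simp only [Nat.cast_add]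
  have h352' : Bound352 P ρ X' (D + D₇ + D₅) := by
    intro s k hk
    rw [hv' k s]
    have e1 := h352 s k hk
    have e2 := h7 s k hk
    have e3 := h5 s k hk
    have : (D + D₇ + D₅) * rFn P.R P.r (epsK P ρ k) ^ P.d * ∑ j ∈ range (k + 1), (X'.nC j s : ℝ)
        = D * rFn P.R P.r (epsK P ρ k) ^ P.d * ∑ j ∈ range (k + 1), (X.nC j s : ℝ)
          + D₇ * rFn P.R P.r (epsK P ρ k) ^ P.d * ∑ j ∈ range (k + 1), (X.nC j s : ℝ)
          + D₅ * rFn P.R P.r (epsK P ρ k) ^ P.d * ∑ j ∈ range (k + 1), (X.nC j s : ℝ) := by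
      show (D + D₇ + D₅) * rFn P.R P.r (epsK P ρ k) ^ P.d * ∑ j ∈ range (k + 1), (X.nC j s : ℝ) = _
      ring
    rw [this]
    linarith
  have hA0 : 0 ≤ a₆ + θ + ρ.C₇ + ρ.C₅ := by positivity
  have hD' : 0 ≤ D + D₇ + D₅ := by positivity
  have hexp := exponent_nonpos P ρ X' hL hR hr hε hK1 hA0 hD' h352' hcond
  have hx1 : ∀ k, k ≤ ρ.K → 1 ≤ xk P ρ k := fun k hk => one_le_xk P ρ hL1 hε hK1 hk
  -- per sequence: F(s) ≤ e^{(C₇+C₅)|T₁⁽ᴷ⁾|} · w(s)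
  have hper : ∀ s : ρ.Seq,
      (∏ k ∈ range ρ.K, ρ.zeta k s)
        * Real.exp (∑ k ∈ range (ρ.K + 1), ρ.C₇ * ((P.L : ℝ) ^ k * ρ.ε) ^ P.κ₀ * (ρ.vol7 k s : ℝ))
        * Real.exp (∑ k ∈ range (ρ.K + 1), ρ.C₅ * (ρ.vol5 k s : ℝ))
      ≤ Real.exp ((ρ.C₇ + ρ.C₅) * (X.volTK : ℝ))
        * Real.exp (-(∑ k ∈ range ρ.K, θ * xk P ρ k * (X.vol0c k s : ℝ))) := by
    intro s
    have hu : ∀ k, k < ρ.K → X.vol0c k s ≤ X'.vol0c k s := fun k _ =>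
      show X.vol0c k s ≤ X.vol0c k s + ρ.vol7 k s + ρ.vol5 k s by omega
    have h7' : ∀ k, k < ρ.K → (ρ.vol7 k s : ℝ) ≤ 1 * xk P ρ k * (X'.vol0c k s : ℝ) := by
      intro k hk
      rw [hv' k s, one_mul]
      have hx := hx1 k hk.le
      have h0 : 0 ≤ (X.vol0c k s : ℝ) + (ρ.vol7 k s : ℝ) + (ρ.vol5 k s : ℝ) := by positivity
      have : (ρ.vol7 k s : ℝ) ≤ (X.vol0c k s : ℝ) + (ρ.vol7 k s : ℝ) + (ρ.vol5 k s : ℝ) := by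
        have h1 : 0 ≤ (X.vol0c k s : ℝ) := Nat.cast_nonneg _
        have h2 : 0 ≤ (ρ.vol5 k s : ℝ) := Nat.cast_nonneg _
        linarith
      nlinarith
    have h5' : ∀ k, k < ρ.K → (ρ.vol5 k s : ℝ) ≤ 1 * xk P ρ k * (X'.vol0c k s : ℝ) := by
      intro k hk
      rw [hv' k s, one_mul]
      have hx := hx1 k hk.le
      have h0 : 0 ≤ (X.vol0c k s : ℝ) + (ρ.vol7 k s : ℝ) + (ρ.vol5 k s : ℝ) := by positivity
      have : (ρ.vol5 k s : ℝ) ≤ (X.vol0c k s : ℝ) + (ρ.vol7 k s : ℝ) + (ρ.vol5 k s : ℝ) := by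
        have h1 : 0 ≤ (X.vol0c k s : ℝ) := Nat.cast_nonneg _
        have h2 : 0 ≤ (ρ.vol7 k s : ℝ) := Nat.cast_nonneg _
        linarith
      nlinarith
    have hs := summand_mul_le_rhs347 P ρ X' X.vol0c hL1 hε hK1 hκ hC₇ hC₅ ha₆ hθ s
      (hz s) (h346 s) hu h7' h5' (h7K s) (h5K s)
    simp only [mul_one] at hs
    -- rhs347 of the combined volume ≤ e^{(C₇+C₅)|T₁⁽ᴷ⁾|} by (3.53)–(3.54)
    have hR : rhs347 P ρ X' (a₆ + θ + ρ.C₇ + ρ.C₅) (ρ.C₇ + ρ.C₅) s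
        ≤ Real.exp ((ρ.C₇ + ρ.C₅) * (X.volTK : ℝ)) := by
      unfold rhs347
      rw [← Real.exp_add]
      calc Real.exp (-(∑ k ∈ range ρ.K, c0 P.a P.γ₀ P.d * pFn P.b₀ P.p (epsK P ρ k) ^ 2 * (X'.nC k s : ℝ))
              + ∑ k ∈ range ρ.K, (a₆ + θ + ρ.C₇ + ρ.C₅) * xk P ρ k * (X'.vol0c k s : ℝ))
            * Real.exp ((ρ.C₇ + ρ.C₅) * (X'.volTK : ℝ))
          ≤ 1 * Real.exp ((ρ.C₇ + ρ.C₅) * (X'.volTK : ℝ)) :=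
            mul_le_mul_of_nonneg_right (Real.exp_le_one_iff.mpr (hexp s)) (Real.exp_pos _).le
        _ = Real.exp ((ρ.C₇ + ρ.C₅) * (X.volTK : ℝ)) := one_mul _
    set F : ℝ := (∏ k ∈ range ρ.K, ρ.zeta k s)
        * Real.exp (∑ k ∈ range (ρ.K + 1), ρ.C₇ * ((P.L : ℝ) ^ k * ρ.ε) ^ P.κ₀ * (ρ.vol7 k s : ℝ))
        * Real.exp (∑ k ∈ range (ρ.K + 1), ρ.C₅ * (ρ.vol5 k s : ℝ))
    set Sθ : ℝ := ∑ k ∈ range ρ.K, θ * xk P ρ k * (X.vol0c k s : ℝ)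
    have e : F = F * Real.exp Sθ * Real.exp (-Sθ) := by
      rw [mul_assoc, ← Real.exp_add, add_neg_cancel, Real.exp_zero, mul_one]
    rw [e]
    exact mul_le_mul_of_nonneg_right (le_trans hs hR) (Real.exp_pos _).le
  -- sum over the sequences
  have hw : ∑ t : ρ.Seq, Real.exp (-(∑ k ∈ range ρ.K, θ * xk P ρ k * (X.vol0c k t : ℝ)))
      ≤ Real.exp (E * (X.volTK : ℝ)) := by
    refine le_trans (le_of_eq (Finset.sum_congr rfl fun t _ => ?_)) hent
    rw [← prod_exp_neg]
  unfold Ineq342With lhs342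
  have hTle : (X.volTK : ℝ) ≤ (ρ.volT : ℝ) := by exact_mod_cast hT
  have hB0 : 0 ≤ ρ.C₇ + ρ.C₅ + E := by positivity
  calc ∑ s : ρ.Seq, (∏ k ∈ range ρ.K, ρ.zeta k s)
          * Real.exp (∑ k ∈ range (ρ.K + 1), ρ.C₇ * ((P.L : ℝ) ^ k * ρ.ε) ^ P.κ₀ * (ρ.vol7 k s : ℝ))
          * Real.exp (∑ k ∈ range (ρ.K + 1), ρ.C₅ * (ρ.vol5 k s : ℝ))
      ≤ ∑ s : ρ.Seq, Real.exp ((ρ.C₇ + ρ.C₅) * (X.volTK : ℝ))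
          * Real.exp (-(∑ k ∈ range ρ.K, θ * xk P ρ k * (X.vol0c k s : ℝ))) :=
        Finset.sum_le_sum fun s _ => hper s
    _ = Real.exp ((ρ.C₇ + ρ.C₅) * (X.volTK : ℝ))
          * ∑ s : ρ.Seq, Real.exp (-(∑ k ∈ range ρ.K, θ * xk P ρ k * (X.vol0c k s : ℝ))) := by
        rw [Finset.mul_sum]
    _ ≤ Real.exp ((ρ.C₇ + ρ.C₅) * (X.volTK : ℝ)) * Real.exp (E * (X.volTK : ℝ)) :=
        mul_le_mul_of_nonneg_left hw (Real.exp_pos _).le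
    _ = Real.exp ((ρ.C₇ + ρ.C₅ + E) * (X.volTK : ℝ)) := by rw [← Real.exp_add]; congr 1; ring
    _ ≤ Real.exp ((ρ.C₇ + ρ.C₅ + E) * (ρ.volT : ℝ)) :=
        Real.exp_le_exp.mpr (mul_le_mul_of_nonneg_left hTle hB0)

/-! ## The claim of Sect. 3.C for a family of runs, WITHOUT the leaf (3.47) -/

/-- **`B2.Claim342Printed` from (3.46) + (3.52)-shape bounds + the sequence count**, uniformly over a family of runs
(the quantifier structure of the decl of record of SKELETON row B2.Eq3.42: threshold ε₁, then ONE constant for every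
run with `0 < ε ≤ ε₀` obeying the stopping rule), STRICT case `2p > (d+1)r`, *"ε₀ is sufficiently small"* =
`ε₀ ≤ min{1, e^{1−x₀}}` with `x₀` from `B2.coeff354_threshold` — exactly as `B2Sect3C.claim342_of_leaves`, but with the
UNPRINTED leaf `Leaf347` replaced by its printed-shape inputs: per run and admissible sequence the (3.46) shape, the
(3.52) bound for `|Λ₀⁽ᵏ⁾ᶜ|` (`Bound352 D`, e.g. from the corridor leaf (3.50)), the (3.52)-shape collar bounds (`D₇`,
`D₅`), the k = K volumes `≤ |T₁⁽ᴷ⁾| ≤ |T_ε|`, the sequence count with constant `E` (discharged for large-block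
sequences by `B2Ineq347SeqCount.entropy_of_blocks`), and O(1)'s `0 ≤ C₇⁽ⁱ⁾ ≤ C₇`, `0 ≤ C₅⁽ⁱ⁾ ≤ C₅` bounded over the family (they are
*"the constant O(1) independent of ε"* of (2.117) p. 582).  The constant of (3.42) is `C₇ + C₅ + E`.
[cite: Balaban1982Higgs2, (3.42) p.592, Sect. 3.C pp.592–594, (2.117) p.582] -/
theorem claim342_of_346 {I : Type} (P : Params) (fam : ℝ → I → Run) (X : ∀ ε₀ i, CData (fam ε₀ i))
    {a₆ θ D D₇ D₅ E C₇ C₅ : ℝ} (hP : P.Printed) (hr : 2 ≤ P.r) (hκ : 0 ≤ P.κ₀)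
    (ha₆ : 0 ≤ a₆) (hθ : 0 ≤ θ) (hD : 0 ≤ D) (hD₇ : 0 ≤ D₇) (hD₅ : 0 ≤ D₅) (hE : 0 ≤ E)
    (hC₇ : 0 ≤ C₇) (hC₅ : 0 ≤ C₅) (hpr : ((P.d : ℝ) + 1) * P.r < 2 * P.p)
    (hC : ∀ ε₀ i, 0 ≤ (fam ε₀ i).C₇ ∧ (fam ε₀ i).C₇ ≤ C₇ ∧ 0 ≤ (fam ε₀ i).C₅ ∧ (fam ε₀ i).C₅ ≤ C₅)
    (hT : ∀ ε₀ i, (X ε₀ i).volTK ≤ (fam ε₀ i).volT)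
    (hz : ∀ ε₀ i s k, k < (fam ε₀ i).K → 0 ≤ (fam ε₀ i).zeta k s)
    (h346 : ∀ ε₀ i s k, k < (fam ε₀ i).K → (fam ε₀ i).zeta k s
        ≤ Real.exp (a₆ * ((X ε₀ i).vol0c k s : ℝ)) *
          Real.exp (-(c0 P.a P.γ₀ P.d * pFn P.b₀ P.p (epsK P (fam ε₀ i) k) ^ 2 * ((X ε₀ i).nC k s : ℝ))))
    (h352 : ∀ ε₀ i, 0 < (fam ε₀ i).ε → (fam ε₀ i).ε ≤ ε₀ → (fam ε₀ i).StopsAt P ε₀ → ε₀ ≤ 1 →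
      Bound352 P (fam ε₀ i) (X ε₀ i) D)
    (h7 : ∀ ε₀ i s k, k < (fam ε₀ i).K → ((fam ε₀ i).vol7 k s : ℝ)
        ≤ D₇ * rFn P.R P.r (epsK P (fam ε₀ i) k) ^ P.d * ∑ j ∈ range (k + 1), ((X ε₀ i).nC j s : ℝ))
    (h5 : ∀ ε₀ i s k, k < (fam ε₀ i).K → ((fam ε₀ i).vol5 k s : ℝ)
        ≤ D₅ * rFn P.R P.r (epsK P (fam ε₀ i) k) ^ P.d * ∑ j ∈ range (k + 1), ((X ε₀ i).nC j s : ℝ))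
    (h7K : ∀ ε₀ i s, (fam ε₀ i).vol7 (fam ε₀ i).K s ≤ (X ε₀ i).volTK)
    (h5K : ∀ ε₀ i s, (fam ε₀ i).vol5 (fam ε₀ i).K s ≤ (X ε₀ i).volTK)
    (hent : ∀ ε₀ i, 0 < (fam ε₀ i).ε → (fam ε₀ i).ε ≤ ε₀ → (fam ε₀ i).StopsAt P ε₀ →
      (letI := (fam ε₀ i).fin; ∑ s : (fam ε₀ i).Seq, ∏ k ∈ range (fam ε₀ i).K,
          Real.exp (-(θ * xk P (fam ε₀ i) k * ((X ε₀ i).vol0c k s : ℝ))))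
        ≤ Real.exp (E * ((X ε₀ i).volTK : ℝ))) :
    Claim342Printed P fam := by
  intro _
  obtain ⟨_, _, hL, _, ha, hγ, hb, hR⟩ := hP
  have hL' : 1 < (P.L : ℝ) := by exact_mod_cast hL
  have hlogL : 0 < Real.log (P.L : ℝ) := Real.log_pos hL'
  have hc : 0 < c0 P.a P.γ₀ P.d := c0_pos ha hγ P.d
  have hA0 : 0 ≤ a₆ + θ + C₇ + C₅ := by positivity
  have hD' : 0 ≤ D + D₇ + D₅ := by positivity
  have hC'0 : 0 ≤ (a₆ + θ + C₇ + C₅) * (D + D₇ + D₅) / (P.R * Real.log (P.L : ℝ)) := by positivity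
  obtain ⟨x₀, _, hx₀⟩ := coeff354_threshold (d := P.d) hc hb hC'0 hR.le hpr
  refine ⟨min 1 (Real.exp (1 - x₀)), lt_min zero_lt_one (Real.exp_pos _), fun ε₀ hε₀ hε₀1 =>
    ⟨C₇ + C₅ + E, ?_⟩⟩
  intro i hε hεle hstop
  have hε₀one : ε₀ ≤ 1 := le_trans hε₀1 (min_le_left _ _)
  have hK1 : epsK P (fam ε₀ i) (fam ε₀ i).K ≤ 1 := le_trans hstop.1 hε₀one
  obtain ⟨h7₀, h7₁, h5₀, h5₁⟩ := hC ε₀ i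
  -- the per-scale (3.54) condition for this run's constants (monotone in the O(1))
  have hcond : ∀ k, k < (fam ε₀ i).K →
      (a₆ + θ + (fam ε₀ i).C₇ + (fam ε₀ i).C₅) * (D + D₇ + D₅) / (P.R * Real.log (P.L : ℝ)) * P.R ^ (P.d + 1)
        ≤ c0 P.a P.γ₀ P.d * P.b₀ ^ 2 * xk P (fam ε₀ i) k ^ (2 * P.p - ((P.d : ℝ) + 1) * P.r) := by
    intro k hk
    have h1 : 1 + Real.log ε₀⁻¹ ≤ xk P (fam ε₀ i) k := logScale_ge hL'.le hε hk hstop.1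
    have h2 : x₀ ≤ 1 + Real.log ε₀⁻¹ := by
      have : Real.log ε₀ ≤ 1 - x₀ := by
        have := Real.log_le_log hε₀ (le_trans hε₀1 (min_le_right _ _))
        rwa [Real.log_exp] at this
      rw [Real.log_inv]
      linarith
    have h3 := hx₀ _ (le_trans h2 h1)
    refine le_trans ?_ h3
    refine mul_le_mul_of_nonneg_right ?_ (pow_nonneg hR.le _)
    refine div_le_div_of_nonneg_right ?_ (by positivity)
    exact mul_le_mul_of_nonneg_right (by linarith) hD'
  have h342 := ineq342_of_346 P (fam ε₀ i) (X ε₀ i) hL' hR hr hε hK1 hκ h7₀ h5₀ ha₆ hθ hD hD₇ hD₅ hE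
    (hT ε₀ i) (hz ε₀ i) (h346 ε₀ i) (h352 ε₀ i hε hεle hstop hε₀one) (h7 ε₀ i) (h5 ε₀ i) (h7K ε₀ i)
    (h5K ε₀ i) (hent ε₀ i hε hεle hstop) hcond
  -- monotonicity of (3.42) in its constant
  unfold Ineq342With at h342 ⊢
  refine le_trans h342 (Real.exp_le_exp.mpr ?_)
  exact mul_le_mul_of_nonneg_right (by linarith) (Nat.cast_nonneg _)

/-! ## End to end for one run -/

/-- **END TO END for one run: (3.42) from printed-shape inputs and the large-block structure of the sequences.**
`ineq342_of_346` with its sequence-count hypothesis discharged by `B2Ineq347SeqCount.entropy_of_blocks` (`E = 1/m`): the remaining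
inputs are the (3.46) shape, `Bound352 D` for `|Λ₀⁽ᵏ⁾ᶜ|` (⇐ the corridor leaf (3.50)), the (3.52)-shape collar bounds,
the k = K volumes, the block data (injection of the sequences into tuples of large-block sets, `|Λ₀⁽ᵏ⁾ᶜ| ≥ m·#blocks`,
`#B_k·m·(Lᵏε)ᵈ ≤ |T₁⁽ᴷ⁾|·(Lᴷε)ᵈ`, `θm ≥ d + 1`) and the per-scale (3.54) condition; conclusion
`B2.Ineq342With P ρ (C₇ + C₅ + 1/m)`. [cite: Balaban1982Higgs2, (3.42) p.592, Sect. 3.C pp.592–594] -/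
theorem ineq342_of_346_blocks (P : Params) (ρ : Run) (X : CData ρ) {a₆ θ D D₇ D₅ m : ℝ}
    (B : Fin ρ.K → Type*) [∀ k, Fintype (B k)] [∀ k, DecidableEq (B k)]
    (ι : ρ.Seq → ∀ k : Fin ρ.K, Finset (B k)) (hι : Function.Injective ι)
    (hL : 2 ≤ (P.L : ℝ)) (hR : 0 < P.R) (hr : 2 ≤ P.r) (hε : 0 < ρ.ε) (hK1 : epsK P ρ ρ.K ≤ 1) (hκ : 0 ≤ P.κ₀)
    (hC₇ : 0 ≤ ρ.C₇) (hC₅ : 0 ≤ ρ.C₅) (ha₆ : 0 ≤ a₆) (hθ : 0 ≤ θ) (hD : 0 ≤ D) (hD₇ : 0 ≤ D₇) (hD₅ : 0 ≤ D₅)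
    (hm : 0 < m) (hθm : (P.d : ℝ) + 1 ≤ θ * m) (hT : X.volTK ≤ ρ.volT)
    (hz : ∀ s k, k < ρ.K → 0 ≤ ρ.zeta k s)
    (h346 : ∀ s k, k < ρ.K → ρ.zeta k s ≤ Real.exp (a₆ * (X.vol0c k s : ℝ)) *
        Real.exp (-(c0 P.a P.γ₀ P.d * pFn P.b₀ P.p (epsK P ρ k) ^ 2 * (X.nC k s : ℝ))))
    (h352 : Bound352 P ρ X D)
    (h7 : ∀ s k, k < ρ.K → (ρ.vol7 k s : ℝ)
        ≤ D₇ * rFn P.R P.r (epsK P ρ k) ^ P.d * ∑ j ∈ range (k + 1), (X.nC j s : ℝ))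
    (h5 : ∀ s k, k < ρ.K → (ρ.vol5 k s : ℝ)
        ≤ D₅ * rFn P.R P.r (epsK P ρ k) ^ P.d * ∑ j ∈ range (k + 1), (X.nC j s : ℝ))
    (h7K : ∀ s, ρ.vol7 ρ.K s ≤ X.volTK) (h5K : ∀ s, ρ.vol5 ρ.K s ≤ X.volTK)
    (hv : ∀ s (k : Fin ρ.K), m * ((ι s k).card : ℝ) ≤ (X.vol0c k s : ℝ))
    (hN : ∀ k : Fin ρ.K,
      (Fintype.card (B k) : ℝ) * m * epsK P ρ k ^ P.d ≤ (X.volTK : ℝ) * epsK P ρ ρ.K ^ P.d)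
    (hcond : ∀ k, k < ρ.K →
        (a₆ + θ + ρ.C₇ + ρ.C₅) * (D + D₇ + D₅) / (P.R * Real.log (P.L : ℝ)) * P.R ^ (P.d + 1)
          ≤ c0 P.a P.γ₀ P.d * P.b₀ ^ 2 * xk P ρ k ^ (2 * P.p - ((P.d : ℝ) + 1) * P.r)) :
    Ineq342With P ρ (ρ.C₇ + ρ.C₅ + 1 / m) := by
  have hL' : 1 < (P.L : ℝ) := by linarith
  have hent := entropy_of_blocks P ρ X B ι hι hL hε hK1 hm hθ hθm hv hN
  rw [show (X.volTK : ℝ) / m = 1 / m * (X.volTK : ℝ) by ring] at hent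
  exact ineq342_of_346 P ρ X hL' hR hr hε hK1 hκ hC₇ hC₅ ha₆ hθ hD hD₇ hD₅ (by positivity) hT hz h346 h352
    h7 h5 h7K h5K hent hcond

end Literature.MathematicalPhysics.QuantumFieldTheory.Balaban1983to89.B2Ineq342From346
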